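import Literature.Barriers.CriticalPhenomena.GridSAWStructuredDrawingBlocks
import Literature.Computability.Complexity.CodeFPLists
import HarnessLib

/-!
# Connectors: the inter-block edges of a stamped grid drawing

Continuation of `GridSAWStructuredDrawingBlocks.lean` (support for the drawing step `E₀` of
`GridSAW.LOT2003_lemma4_gadgets`, Liśkiewicz–Ogihara–Toda 2003, §4). After the templates are
stamped (`SDrawing.blocks L`, valid by `BlocksOK.isValid`), the edges between blocks are added with
`SDrawing.addEdges`; their admissibility `NewEdgesOK` (`GridSAWStructuredDrawingCompose.lean`) has
two clauses that quantify over the OLD drawing (paths meet vertex images only at their ends; a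
point shared with an old edge is a vertex image). This file reduces them to one point-set
condition and supplies the straight grid segments connectors are made of:

* `ConnectorsOK S E` — the local shape conditions of `NewEdgesOK`, plus
  `interior_free : ∀ e ∈ E, ∀ p ∈ π_e, p ∈ S.points → p = pos e.1 ∨ p = pos e.2.1`
  in place of `interior`/`disjoint_old`; **`ConnectorsOK.newEdgesOK`** (for valid `S`) and
  `BlocksOK.isValid_addEdges`;
* for block drawings: `BlocksOK.exists_box_of_mem_points` (a point of `blocks L` lies in some
  box `v + [0, w) × [0, h)`), `BlocksOK.block_eq_of_name_eq` (a name determines its block),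
  `BlocksOK.not_sameEndsS_blocks` (a connector between two different blocks repeats no old end
  pair);
* the graph drawn: `graph_adj_addEdges`, **`BlocksOK.blocks_graph_adj_iff`**,
  `BlocksOK.blocks_graph_adj_shift` (inside a block the drawn graph is the template graph),
  `BlocksOK.not_blocks_graph_adj` (no adjacency across blocks) — the dictionary for transferring
  a census proved on names to the drawn graph (`hamCount_congr_adj`);
* `hseg x y n` / `vseg x y n` — the horizontal / vertical grid segment from `(x, y)` to
  `(x + n, y)` / `(x, y + n)`: membership, ends, `Nodup`, `IsChain IsGridEdge`, length, and typed
  polynomial time (`codeFP_hseg`, `codeFP_vseg`, with the length capped by a unary budget;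
  `codeFP_hseg'`, `codeFP_vseg'` for computed arguments under a computed budget).

The references for the `CodeFP` part: Arora–Barak 2009, §1.3.

## References

* M. Liśkiewicz, M. Ogihara, S. Toda, TCS 304 (2003) 129–156, §4 (proof of Theorem 7: "for every
  two edges the paths which realize the edges in the two-dimensional grid are vertex disjoint").
-/

namespace Literature.Barriers.CriticalPhenomena.GridSAW

namespace SDrawing

/-! ### Connectors over a drawing -/

section Connectors

variable {α : Type*} [DecidableEq α]

/-- **Admissible connectors** over a drawing `S`: each new edge joins two distinct listed vertices
by a self-avoiding grid path between their images; a point of the path that is a point of `S`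
(vertex image or point of an old edge) is one of its two end images; a point common to two new
edges is a vertex image; no repeated end pairs; degrees stay at most three.
[cite: LiskiewiczOgiharaToda2003, §4 (proof of Theorem 7, "no vertex congestion")] -/
structure ConnectorsOK (S : SDrawing α) (E : List (SEdge α)) : Prop where
  /-- ends are listed vertices -/
  fst_mem : ∀ e ∈ E, e.1 ∈ S.verts
  /-- ends are listed vertices -/
  snd_mem : ∀ e ∈ E, e.2.1 ∈ S.verts
  /-- no loops -/
  fst_ne_snd : ∀ e ∈ E, e.1 ≠ e.2.1
  /-- the path starts at the first end -/
  head?_eq : ∀ e ∈ E, e.2.2.head? = some (S.pos e.1)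
  /-- the path ends at the second end -/
  getLast?_eq : ∀ e ∈ E, e.2.2.getLast? = some (S.pos e.2.1)
  /-- the path is self-avoiding -/
  nodup_path : ∀ e ∈ E, e.2.2.Nodup
  /-- the path is a grid path -/
  isChain_path : ∀ e ∈ E, List.IsChain IsGridEdge e.2.2
  /-- the path meets the old drawing only at its two end images -/
  interior_free : ∀ e ∈ E, ∀ p ∈ e.2.2, p ∈ S.points → p = S.pos e.1 ∨ p = S.pos e.2.1
  /-- a common point of two new edges is a vertex image -/
  disjoint_new : E.Pairwise fun e e' => ∀ p ∈ e.2.2, p ∈ e'.2.2 → ∃ v ∈ S.verts, S.pos v = p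
  /-- no new edge repeats an old end pair -/
  simple_old : ∀ e ∈ E, ∀ e' ∈ S.edges, ¬ SameEndsS e e'
  /-- no two new edges with the same end pair -/
  simple_new : E.Pairwise fun e e' => ¬ SameEndsS e e'
  /-- degrees stay at most three -/
  degree_le : ∀ v ∈ S.verts, S.degree v + E.countP (fun e => decide (e.1 = v ∨ e.2.1 = v)) ≤ 3

/-- **Admissible connectors are admissible new edges** (over a valid drawing). [cite: LiskiewiczOgiharaToda2003, §4 (proof of Theorem 7)] -/
theorem ConnectorsOK.newEdgesOK {S : SDrawing α} (hS : S.IsValid) {E : List (SEdge α)} (h : ConnectorsOK S E) :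
    NewEdgesOK S E where
  fst_mem := h.fst_mem
  snd_mem := h.snd_mem
  fst_ne_snd := h.fst_ne_snd
  head?_eq := h.head?_eq
  getLast?_eq := h.getLast?_eq
  nodup_path := h.nodup_path
  isChain_path := h.isChain_path
  interior e he v hv hp := by
    rcases h.interior_free e he _ hp (S.pos_mem_points hv) with h1 | h1
    exacts [Or.inl (hS.pos_inj v hv _ (h.fst_mem e he) h1), Or.inr (hS.pos_inj v hv _ (h.snd_mem e he) h1)]
  disjoint_old e he e' he' p hp hp' := by
    rcases h.interior_free e he p hp (S.path_mem_points he' hp') with rfl | rfl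
    exacts [⟨e.1, h.fst_mem e he, rfl⟩, ⟨e.2.1, h.snd_mem e he, rfl⟩]
  disjoint_new := h.disjoint_new
  simple_old := h.simple_old
  simple_new := h.simple_new
  degree_le := h.degree_le

/-- **Stamped blocks plus admissible connectors form a valid drawing.** [cite: LiskiewiczOgiharaToda2003, §4 (proof of Theorem 7, E₀)] -/
theorem BlocksOK.isValid_addEdges {B w h : ℕ} {L : List Block} (hL : BlocksOK B w h L) {E : List (SEdge ℕ)}
    (hE : ConnectorsOK (blocks L) E) : ((blocks L).addEdges E).IsValid :=
  hL.isValid.addEdges (hE.newEdgesOK hL.isValid)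

end Connectors

/-! ### Block drawings: where the points are, which block a name belongs to -/

section BlockFacts

variable {B w h : ℕ} {L : List Block}

/-- **A point of a block drawing lies in the box of some block.** [folklore] -/
theorem BlocksOK.exists_box_of_mem_points (hL : BlocksOK B w h L) {p : GridPoint} (hp : p ∈ (blocks L).points) :
    ∃ b ∈ L, b.2.2.1 ≤ p.1 ∧ p.1 < b.2.2.1 + (w : ℤ) ∧ b.2.2.2 ≤ p.2 ∧ p.2 < b.2.2.2 + (h : ℤ) := by
  obtain ⟨b, hb, q, hq, rfl⟩ := hL.mem_points_blocks.1 hp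
  have hq' := hL.inBox b hb q hq
  refine ⟨b, hb, ?_⟩
  simp only [shift]
  omega

/-- A point outside every box is not a point of the block drawing. [folklore] -/
theorem BlocksOK.not_mem_points (hL : BlocksOK B w h L) {p : GridPoint}
    (hp : ∀ b ∈ L, ¬ (b.2.2.1 ≤ p.1 ∧ p.1 < b.2.2.1 + (w : ℤ) ∧ b.2.2.2 ≤ p.2 ∧ p.2 < b.2.2.2 + (h : ℤ))) :
    p ∉ (blocks L).points := fun hmem => by
  obtain ⟨b, hb, hbox⟩ := hL.exists_box_of_mem_points hmem
  exact hp b hb hbox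

/-- Two members of an admissible block list are equal or have apart name offsets. [folklore] -/
theorem BlocksOK.eq_or_apart (hL : BlocksOK B w h L) {b c : Block} (hb : b ∈ L) (hc : c ∈ L) :
    b = c ∨ (b.2.1 + B ≤ c.2.1 ∨ c.2.1 + B ≤ b.2.1) := by
  obtain ⟨i, hi, rfl⟩ := List.mem_iff_getElem.1 hb
  obtain ⟨j, hj, rfl⟩ := List.mem_iff_getElem.1 hc
  have hP := List.pairwise_iff_getElem.1 hL.names_apart
  rcases lt_trichotomy i j with hij | rfl | hij
  · exact Or.inr (hP i j hi hj hij)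
  · exact Or.inl rfl
  · exact Or.inr (hP j i hj hi hij).symm

/-- **A name of a block drawing determines its block** (and its template name). [folklore] -/
theorem BlocksOK.block_eq_of_name_eq (hL : BlocksOK B w h L) {b c : Block} (hb : b ∈ L) (hc : c ∈ L) {a u : ℕ}
    (ha : a ∈ b.1.verts) (hu : u ∈ c.1.verts) (hau : a + b.2.1 = u + c.2.1) : b = c ∧ a = u := by
  have h1 := hL.names_lt b hb a ha
  have h2 := hL.names_lt c hc u hu
  rcases hL.eq_or_apart hb hc with rfl | h0 | h0
  · exact ⟨rfl, by omega⟩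
  · omega
  · omega

/-- The offset version. [folklore] -/
theorem BlocksOK.offset_eq_of_name_eq (hL : BlocksOK B w h L) {b c : Block} (hb : b ∈ L) (hc : c ∈ L) {a u : ℕ}
    (ha : a ∈ b.1.verts) (hu : u ∈ c.1.verts) (hau : a + b.2.1 = u + c.2.1) : b.2.1 = c.2.1 ∧ a = u := by
  obtain ⟨rfl, rfl⟩ := hL.block_eq_of_name_eq hb hc ha hu hau
  exact ⟨rfl, rfl⟩

/-- **A connector between two different blocks repeats no end pair of the block drawing** (old
edges join two names of one block). [folklore] -/
theorem BlocksOK.not_sameEndsS_blocks (hL : BlocksOK B w h L) {b c : Block} (hb : b ∈ L) (hc : c ∈ L) {a a' : ℕ}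
    (ha : a ∈ b.1.verts) (ha' : a' ∈ c.1.verts) (hne : b ≠ c) (π : List GridPoint) {e' : SEdge ℕ}
    (he' : e' ∈ (blocks L).edges) : ¬ SameEndsS (a + b.2.1, a' + c.2.1, π) e' := by
  obtain ⟨d, hd, e₀, he₀, rfl⟩ := mem_blocks_edges.1 he'
  have hv := hL.valid d hd
  rintro (⟨h1, h2⟩ | ⟨h1, h2⟩)
  · have hb' := hL.block_eq_of_name_eq hb hd ha (hv.fst_mem e₀ he₀) h1
    have hc' := hL.block_eq_of_name_eq hc hd ha' (hv.snd_mem e₀ he₀) h2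
    exact hne (hb'.1.trans hc'.1.symm)
  · have hb' := hL.block_eq_of_name_eq hb hd ha (hv.snd_mem e₀ he₀) h1
    have hc' := hL.block_eq_of_name_eq hc hd ha' (hv.fst_mem e₀ he₀) h2
    exact hne (hb'.1.trans hc'.1.symm)

end BlockFacts

/-! ### The graph drawn by blocks and connectors -/

section Graph

variable {α : Type*} [DecidableEq α]

omit [DecidableEq α] in
/-- Adjacency after adding edges: an old adjacency or a new end pair. [folklore] -/
theorem graph_adj_addEdges (S : SDrawing α) (E : List (SEdge α)) {x y : α} :
    (S.addEdges E).graph.Adj x y ↔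
      S.graph.Adj x y ∨ (x ≠ y ∧ ∃ d ∈ E, (d.1 = x ∧ d.2.1 = y) ∨ (d.1 = y ∧ d.2.1 = x)) := by
  simp only [graph_adj_iff, addEdges, List.mem_append]
  constructor
  · rintro ⟨hne, d, hd | hd, h⟩
    exacts [Or.inl ⟨hne, d, hd, h⟩, Or.inr ⟨hne, d, hd, h⟩]
  · rintro (⟨hne, d, hd, h⟩ | ⟨hne, d, hd, h⟩)
    exacts [⟨hne, d, Or.inl hd, h⟩, ⟨hne, d, Or.inr hd, h⟩]

variable {B w h : ℕ} {L : List Block}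

/-- **Adjacency in the graph of a block drawing**: a template adjacency inside one block, shifted.
[folklore] -/
theorem BlocksOK.blocks_graph_adj_iff (hL : BlocksOK B w h L) {x y : ℕ} :
    (blocks L).graph.Adj x y ↔
      ∃ b ∈ L, ∃ a ∈ b.1.verts, ∃ a' ∈ b.1.verts, a + b.2.1 = x ∧ a' + b.2.1 = y ∧ b.1.graph.Adj a a' := by
  rw [graph_adj_iff]
  constructor
  · rintro ⟨hne, d, hd, h⟩
    obtain ⟨b, hb, e₀, he₀, rfl⟩ := mem_blocks_edges.1 hd
    have hv := hL.valid b hb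
    rcases h with ⟨rfl, rfl⟩ | ⟨rfl, rfl⟩
    · exact ⟨b, hb, e₀.1, hv.fst_mem e₀ he₀, e₀.2.1, hv.snd_mem e₀ he₀, rfl, rfl,
        (graph_adj_iff _).2 ⟨hv.fst_ne_snd e₀ he₀, e₀, he₀, Or.inl ⟨rfl, rfl⟩⟩⟩
    · exact ⟨b, hb, e₀.2.1, hv.snd_mem e₀ he₀, e₀.1, hv.fst_mem e₀ he₀, rfl, rfl,
        (graph_adj_iff _).2 ⟨(hv.fst_ne_snd e₀ he₀).symm, e₀, he₀, Or.inr ⟨rfl, rfl⟩⟩⟩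
  · rintro ⟨b, hb, a, ha, a', ha', rfl, rfl, hadj⟩
    obtain ⟨hne, e₀, he₀, h⟩ := (graph_adj_iff _).1 hadj
    refine ⟨fun h' => hne (by omega), (e₀.1 + b.2.1, e₀.2.1 + b.2.1, e₀.2.2.map (shift b.2.2)),
      mem_blocks_edges.2 ⟨b, hb, e₀, he₀, rfl⟩, ?_⟩
    rcases h with ⟨rfl, rfl⟩ | ⟨rfl, rfl⟩
    exacts [Or.inl ⟨rfl, rfl⟩, Or.inr ⟨rfl, rfl⟩]

/-- **Inside a block the drawn graph is the template graph** (shifted). [folklore] -/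
theorem BlocksOK.blocks_graph_adj_shift (hL : BlocksOK B w h L) {b : Block} (hb : b ∈ L) {a a' : ℕ}
    (ha : a ∈ b.1.verts) (ha' : a' ∈ b.1.verts) :
    (blocks L).graph.Adj (a + b.2.1) (a' + b.2.1) ↔ b.1.graph.Adj a a' := by
  rw [hL.blocks_graph_adj_iff]
  constructor
  · rintro ⟨c, hc, u, hu, u', hu', hux, huy, hadj⟩
    obtain ⟨rfl, rfl⟩ := hL.block_eq_of_name_eq hc hb hu ha hux
    obtain ⟨-, rfl⟩ := hL.block_eq_of_name_eq hc hb hu' ha' huy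
    exact hadj
  · exact fun hadj => ⟨b, hb, a, ha, a', ha', rfl, rfl, hadj⟩

/-- **Names of different blocks are not adjacent in the block drawing.** [folklore] -/
theorem BlocksOK.not_blocks_graph_adj (hL : BlocksOK B w h L) {b c : Block} (hb : b ∈ L) (hc : c ∈ L) {a a' : ℕ}
    (ha : a ∈ b.1.verts) (ha' : a' ∈ c.1.verts) (hne : b ≠ c) : ¬ (blocks L).graph.Adj (a + b.2.1) (a' + c.2.1) := by
  rw [hL.blocks_graph_adj_iff]
  rintro ⟨d, hd, u, hu, u', hu', hux, huy, -⟩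
  have h1 := (hL.block_eq_of_name_eq hd hb hu ha hux).1
  have h2 := (hL.block_eq_of_name_eq hd hc hu' ha' huy).1
  exact hne (h1.symm.trans h2)

end Graph

/-! ### Straight segments -/

section Segments

/-- **The horizontal grid segment** from `(x, y)` to `(x + n, y)`. [cite: LiskiewiczOgiharaToda2003, §4 ("straight line")] -/
def hseg (x y : ℤ) (n : ℕ) : List GridPoint := (List.range (n + 1)).map fun i : ℕ => (x + (i : ℤ), y)

/-- **The vertical grid segment** from `(x, y)` to `(x, y + n)`. [cite: LiskiewiczOgiharaToda2003, §4 ("straight line")] -/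
def vseg (x y : ℤ) (n : ℕ) : List GridPoint := (List.range (n + 1)).map fun i : ℕ => (x, y + (i : ℤ))

/-- The points of a horizontal segment. [folklore] -/
theorem mem_hseg {x y : ℤ} {n : ℕ} {p : GridPoint} : p ∈ hseg x y n ↔ p.2 = y ∧ x ≤ p.1 ∧ p.1 ≤ x + n := by
  constructor
  · intro hp
    obtain ⟨i, hi, rfl⟩ := List.mem_map.1 hp
    rw [List.mem_range] at hi
    refine ⟨rfl, ?_, ?_⟩ <;> dsimp only <;> omega
  · rintro ⟨hy, h1, h2⟩
    refine List.mem_map.2 ⟨(p.1 - x).toNat, List.mem_range.2 (by omega), ?_⟩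
    rw [Int.toNat_of_nonneg (by omega)]
    ext <;> dsimp only <;> omega

/-- The points of a vertical segment. [folklore] -/
theorem mem_vseg {x y : ℤ} {n : ℕ} {p : GridPoint} : p ∈ vseg x y n ↔ p.1 = x ∧ y ≤ p.2 ∧ p.2 ≤ y + n := by
  constructor
  · intro hp
    obtain ⟨i, hi, rfl⟩ := List.mem_map.1 hp
    rw [List.mem_range] at hi
    refine ⟨rfl, ?_, ?_⟩ <;> dsimp only <;> omega
  · rintro ⟨hx, h1, h2⟩
    refine List.mem_map.2 ⟨(p.2 - y).toNat, List.mem_range.2 (by omega), ?_⟩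
    rw [Int.toNat_of_nonneg (by omega)]
    ext <;> dsimp only <;> omega

/-- A horizontal segment has `n + 1` points. [folklore] -/
@[simp] theorem length_hseg (x y : ℤ) (n : ℕ) : (hseg x y n).length = n + 1 := by simp [hseg]

/-- A vertical segment has `n + 1` points. [folklore] -/
@[simp] theorem length_vseg (x y : ℤ) (n : ℕ) : (vseg x y n).length = n + 1 := by simp [vseg]

/-- A horizontal segment starts at `(x, y)`. [folklore] -/
theorem head?_hseg (x y : ℤ) (n : ℕ) : (hseg x y n).head? = some (x, y) := by
  simp [hseg, List.range_succ_eq_map]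

/-- A vertical segment starts at `(x, y)`. [folklore] -/
theorem head?_vseg (x y : ℤ) (n : ℕ) : (vseg x y n).head? = some (x, y) := by
  simp [vseg, List.range_succ_eq_map]

/-- A horizontal segment ends at `(x + n, y)`. [folklore] -/
theorem getLast?_hseg (x y : ℤ) (n : ℕ) : (hseg x y n).getLast? = some (x + n, y) := by
  rw [hseg, List.getLast?_map, List.getLast?_range]
  simp

/-- A vertical segment ends at `(x, y + n)`. [folklore] -/
theorem getLast?_vseg (x y : ℤ) (n : ℕ) : (vseg x y n).getLast? = some (x, y + n) := by
  rw [vseg, List.getLast?_map, List.getLast?_range]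
  simp

/-- A horizontal segment is self-avoiding. [folklore] -/
theorem nodup_hseg (x y : ℤ) (n : ℕ) : (hseg x y n).Nodup := by
  refine (List.nodup_range).map fun i j hij => ?_
  simp only [Prod.mk.injEq] at hij
  omega

/-- A vertical segment is self-avoiding. [folklore] -/
theorem nodup_vseg (x y : ℤ) (n : ℕ) : (vseg x y n).Nodup := by
  refine (List.nodup_range).map fun i j hij => ?_
  simp only [Prod.mk.injEq] at hij
  omega

/-- A horizontal segment is a grid path. [folklore] -/
theorem isChain_hseg (x y : ℤ) (n : ℕ) : List.IsChain IsGridEdge (hseg x y n) := by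
  unfold hseg
  refine List.isChain_map_of_isChain (R := fun i j : ℕ => j = i + 1) _ ?_ ?_
  · intro i j hij
    subst hij
    refine Or.inr ⟨rfl, ?_⟩
    push_cast
    rw [show x + (i : ℤ) - (x + ((i : ℤ) + 1)) = -1 by ring]
    rfl
  · exact List.isChain_range_succ _ _ |>.mpr fun _ _ => rfl

/-- A vertical segment is a grid path. [folklore] -/
theorem isChain_vseg (x y : ℤ) (n : ℕ) : List.IsChain IsGridEdge (vseg x y n) := by
  unfold vseg
  refine List.isChain_map_of_isChain (R := fun i j : ℕ => j = i + 1) _ ?_ ?_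
  · intro i j hij
    subst hij
    refine Or.inl ⟨rfl, ?_⟩
    push_cast
    rw [show y + (i : ℤ) - (y + ((i : ℤ) + 1)) = -1 by ring]
    rfl
  · exact List.isChain_range_succ _ _ |>.mpr fun _ _ => rfl

/-- Sanity check: the segment from `(0,0)` to `(2,0)`. [folklore] -/
example : hseg 0 0 2 = [((0 : ℤ), (0 : ℤ)), (1, 0), (2, 0)] := by decide

/-! ### Segments are typed polynomial time (length bounded by a unary budget) -/

section FP

open _root_.Computability Literature.Computability.Complexity Literature.Computability.Complexity.CodeFP

/-- The indices `0, …, min n u` of a segment of requested length `n` under the unary budget `u`.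
[cite: AroraBarak2009, §1.3] -/
theorem codeFP_segRange :
    CodeFP (pairE unE (pairE smE (pairE smE natE))) (rawE natE) (fun p => List.range (min p.2.2.2 p.1 + 1)) := by
  have hu : CodeFP (pairE unE (pairE smE (pairE smE natE))) unE (fun p => p.1 + 1) := unSucc.comp (fst _ _)
  have hn : CodeFP (pairE unE (pairE smE (pairE smE natE))) natE (fun p => p.2.2.2 + 1) :=
    (natAdd.comp ((snd _ _).snd'.snd'.pair (const _ 1))).congr fun _ => rfl
  exact (rangeOf.comp (hu.pair hn)).congr fun p => congrArg List.range (by dsimp only; omega)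

/-- **The horizontal segment** `(u, x, y, n) ↦ hseg x y (min n u)` (the length capped by the unary
budget `u`). [cite: AroraBarak2009, §1.3] -/
theorem codeFP_hseg :
    CodeFP (pairE unE (pairE smE (pairE smE natE))) (rawE gpC) (fun p => hseg p.2.1 p.2.2.1 (min p.2.2.2 p.1)) := by
  have hx : CodeFP (pairE (pairE unE (pairE smE (pairE smE natE))) natE) smE (fun q => q.1.2.1) := (fst _ _).snd'.fst'
  have hy : CodeFP (pairE (pairE unE (pairE smE (pairE smE natE))) natE) smE (fun q => q.1.2.2.1) :=
    (fst _ _).snd'.snd'.fst'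
  have hi : CodeFP (pairE (pairE unE (pairE smE (pairE smE natE))) natE) smE (fun q => (q.2 : ℤ)) :=
    (smOfInt.comp (intOfNat.comp (snd _ _))).congr fun _ => rfl
  have hitem : CodeFP (pairE (pairE unE (pairE smE (pairE smE natE))) natE) gpC (fun q => (q.1.2.1 + (q.2 : ℤ), q.1.2.2.1)) :=
    ((codeFP_smAdd.comp (hx.pair hi)).pair hy).congr fun _ => rfl
  exact ((map hitem).comp ((CodeFP.id _).pair codeFP_segRange)).congr fun _ => rfl

/-- **The vertical segment** `(u, x, y, n) ↦ vseg x y (min n u)`. [cite: AroraBarak2009, §1.3] -/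
theorem codeFP_vseg :
    CodeFP (pairE unE (pairE smE (pairE smE natE))) (rawE gpC) (fun p => vseg p.2.1 p.2.2.1 (min p.2.2.2 p.1)) := by
  have hx : CodeFP (pairE (pairE unE (pairE smE (pairE smE natE))) natE) smE (fun q => q.1.2.1) := (fst _ _).snd'.fst'
  have hy : CodeFP (pairE (pairE unE (pairE smE (pairE smE natE))) natE) smE (fun q => q.1.2.2.1) :=
    (fst _ _).snd'.snd'.fst'
  have hi : CodeFP (pairE (pairE unE (pairE smE (pairE smE natE))) natE) smE (fun q => (q.2 : ℤ)) :=
    (smOfInt.comp (intOfNat.comp (snd _ _))).congr fun _ => rfl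
  have hitem : CodeFP (pairE (pairE unE (pairE smE (pairE smE natE))) natE) gpC (fun q => (q.1.2.1, q.1.2.2.1 + (q.2 : ℤ))) :=
    (hx.pair (codeFP_smAdd.comp (hy.pair hi))).congr fun _ => rfl
  exact ((map hitem).comp ((CodeFP.id _).pair codeFP_segRange)).congr fun _ => rfl

/-- A computed horizontal segment whose length is bounded by a computed unary budget. [cite: AroraBarak2009, §1.3] -/
theorem codeFP_hseg' {β : Type} {eβ : β → List Bool} {u : β → ℕ} {x y : β → ℤ} {n : β → ℕ} (hu : CodeFP eβ unE u)
    (hx : CodeFP eβ smE x) (hy : CodeFP eβ smE y) (hn : CodeFP eβ natE n) (hle : ∀ b, n b ≤ u b) :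
    CodeFP eβ (rawE gpC) (fun b => hseg (x b) (y b) (n b)) :=
  (codeFP_hseg.comp (hu.pair (hx.pair (hy.pair hn)))).congr fun b => by
    dsimp only
    rw [Nat.min_eq_left (hle b)]

/-- A computed vertical segment whose length is bounded by a computed unary budget. [cite: AroraBarak2009, §1.3] -/
theorem codeFP_vseg' {β : Type} {eβ : β → List Bool} {u : β → ℕ} {x y : β → ℤ} {n : β → ℕ} (hu : CodeFP eβ unE u)
    (hx : CodeFP eβ smE x) (hy : CodeFP eβ smE y) (hn : CodeFP eβ natE n) (hle : ∀ b, n b ≤ u b) :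
    CodeFP eβ (rawE gpC) (fun b => vseg (x b) (y b) (n b)) :=
  (codeFP_vseg.comp (hu.pair (hx.pair (hy.pair hn)))).congr fun b => by
    dsimp only
    rw [Nat.min_eq_left (hle b)]

end FP

end Segments

end SDrawing

end Literature.Barriers.CriticalPhenomena.GridSAW
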